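import Mathlib
import Literature.Probability.Percolation.Crossings
import Literature.Probability.Percolation.SiteConnectionTools
import Literature.Probability.Percolation.BondPercolationSymmetry
import Literature.Probability.Percolation.LatticeSymmetry
import Literature.Probability.Percolation.InequalitiesProofs
import Literature.Probability.Percolation.MinOpenCut
import Literature.Probability.Percolation.SupercriticalClusterTransienceCorners
import Literature.Probability.Percolation.RSW
import Literature.Probability.LatticeModels.RandomClusterDomainToBox
import Summits.CriticalPhenomena.PercolationContinuityZ3.Theorems.PinholeClosing.Negative.PinholeClosingBaseline
import HarnessLib

/-!
# Crux `PercBudgetLadder.PinholeClosing` (stmt-CriticalPhenomena-5249), line `halfspace-polarisation` — stub `stub_slabTiling`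

Helper file for the crux skeleton `Cruxes/PinholeClosing/Lines/halfspace_polarisation.lean`
(lead prover-line-stmt-CriticalPhenomena-5249-0); proves exactly the registered stub `stub_slabTiling`
(`--supports stmt-CriticalPhenomena-5249`).  No new definitions: statements are in the tree's vocabulary
(`bondPercolation (zdGraph 3) (criticalProbI 3)`, `box`, `innerBoundary`, `openConnIn`).

**Slab tiling (deterministic).**  Parameters `1 ≤ n`, `n + 1 ≤ a`, `n + 1 ≤ L`, `a + L = 2ln =: M`;
`ω ⊆ E(ℤ³)` a lattice bond configuration.  A *tile* is indexed by `t = (i, σ, w)` with `i : Fin 3`,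
`σ = ±1`, `w ∈ box 3 l`; its centre is `z_t := update ((2n+1) • w) i (σ a)` and it is *front-blocked*
if there is no `ω`-open path from `z_t + box n` to `z_t + ∂ⁱⁿ box L` inside the closed front half
`{v | v - z_t ∈ box L ∧ 0 ≤ σ (v - z_t)_i}` of the translated box.  Claim: if every tile is
front-blocked then there is no `ω`-open crossing of the annulus `box n → ∂ⁱⁿ box M` inside `box M`.

Proof.  An open crossing `x₀ → b` inside `box M` is a walk of `openGraph ω ≤ zdGraph 3`, so every step
changes one coordinate by `±1` (`zdGraph_adj_apply_le`).  The endpoint `b ∈ ∂ⁱⁿ box M` lies on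
a face, `σ b_i = M = a + L` (`exists_eq_of_mem_innerBoundary_box`), while `σ (x₀)_i ≤ n < a`.
(A) *Last exit* (`StubSlabTiling.last_exit`, induction on walks): the walk has a vertex `u` with
`σ u_i = a` after which it stays in the half-space `{σ v_i ≥ a}`.  (B) *Grid rounding*: Euclidean
division of `u_j + n` by `2n + 1` (`j ≠ i`) gives `w ∈ box 3 l` with `u ∈ z_t + box n`,
`t = (i, σ, w)`.  (C) the tail of the walk lies in the front half-space of this tile, and (D) *first
exit* (`StubSlabTiling.first_exit`, induction on walks, as in `exists_innerBoundary_reachable_of_walk`):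
since `σ (b - z_t)_i = L`, the tail leaves `z_t + box (L-1)`, and its initial segment up to the first
vertex `y` outside is an open path inside the front half of `z_t + box L` from `u` to
`y ∈ z_t + ∂ⁱⁿ box L` (`mem_innerBoundary_box_succ_of_notMem`) — contradicting that the tile `t` is
front-blocked.
-/

noncomputable section

namespace Summit.CriticalPhenomena.PercolationContinuityZ3.Theorems

open MeasureTheory Filter
open Literature.Probability.Percolation Literature.Probability.LatticeModels
open Summit.CriticalPhenomena.PercolationContinuityZ3.Theorems.PinholeClosing.Negative

namespace StubSlabTiling

/-! ### §1 Lattice arithmetic -/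

/-- On a lattice configuration `ω ⊆ E(ℤ³)`, open edges are nearest-neighbour edges. -/
theorem zdGraph_adj_of_openGraph_adj {ω : BondConfig (Site 3)} (hω : ω ⊆ (zdGraph 3).edgeSet)
    {u v : Site 3} (h : (openGraph ω).Adj u v) : (zdGraph 3).Adj u v :=
  hω ((openGraph_adj _ _ _).1 h).1

/-- For a sign `σ = ±1`: `σ (x - σ a) = σ x - a`. -/
theorem sign_mul_sub {σ : ℤ} (hσ : σ = 1 ∨ σ = -1) (x a : ℤ) : σ * (x - σ * a) = σ * x - a := by
  rcases hσ with rfl | rfl <;> ring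

/-- Grid rounding: with `q := (x + n) / (2n+1)` (Euclidean division), `x - (2n+1) q ∈ [-n, n]`. -/
theorem sub_mul_ediv_mem (n : ℕ) (x : ℤ) :
    -(n : ℤ) ≤ x - (2 * (n : ℤ) + 1) * ((x + n) / (2 * (n : ℤ) + 1)) ∧
      x - (2 * (n : ℤ) + 1) * ((x + n) / (2 * (n : ℤ) + 1)) ≤ n := by
  have hpos : (0 : ℤ) < 2 * (n : ℤ) + 1 := by positivity
  have h1 := Int.mul_ediv_add_emod (x + n) (2 * (n : ℤ) + 1)
  have h2 := Int.emod_nonneg (x + n) hpos.ne'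
  have h3 := Int.emod_lt_of_pos (x + n) hpos
  constructor <;> linarith

/-- Grid rounding stays in range: `|x| ≤ 2ln` implies `|(x + n) / (2n+1)| ≤ l`. -/
theorem ediv_mem_range {n l : ℕ} {M x : ℤ} (hM : 2 * (l : ℤ) * n = M) (hx : -M ≤ x ∧ x ≤ M) :
    -(l : ℤ) ≤ (x + n) / (2 * (n : ℤ) + 1) ∧ (x + n) / (2 * (n : ℤ) + 1) ≤ l := by
  have hpos : (0 : ℤ) < 2 * (n : ℤ) + 1 := by positivity
  have hl0 : (0 : ℤ) ≤ l := by positivity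
  have hn0 : (0 : ℤ) ≤ n := by positivity
  obtain ⟨hx1, hx2⟩ := hx
  constructor
  · rw [Int.le_ediv_iff_mul_le hpos]
    linarith
  · have h : (x + n) / (2 * (n : ℤ) + 1) < l + 1 := by
      rw [Int.ediv_lt_iff_lt_mul hpos]
      linarith
    exact Int.lt_add_one_iff.1 h

/-! ### §2 Last exit below a level -/

/-- **Last exit.**  Let `f` change by at most `+1` along edges of `H`.  A walk ending at level `≥ a`
that visits a vertex of level `< a` contains a vertex `u` of level exactly `a` followed by a terminal
sub-walk entirely at levels `≥ a` (induction on the walk: the last low vertex is followed by `u`). -/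
theorem last_exit {V : Type*} {H : SimpleGraph V} (f : V → ℤ) (a : ℤ)
    (hf : ∀ u v, H.Adj u v → f v ≤ f u + 1) :
    ∀ {v b : V} (p : H.Walk v b), a ≤ f b → (∃ v' ∈ p.support, f v' < a) →
      ∃ u, f u = a ∧ ∃ q : H.Walk u b, (∀ v' ∈ q.support, a ≤ f v') ∧ q.support ⊆ p.support := by
  intro v b p
  induction p with
  | nil =>
    rintro hb ⟨v', hv', hlt⟩
    rw [SimpleGraph.Walk.support_nil, List.mem_singleton] at hv'
    subst hv'
    omega
  | @cons v v₁ _ h p' ih =>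
    rintro hb ⟨v', hv', hlt⟩
    by_cases hlow : ∃ v'' ∈ p'.support, f v'' < a
    · obtain ⟨u, hu, q, hq, hsub⟩ := ih hb hlow
      refine ⟨u, hu, q, hq, fun x hx => ?_⟩
      rw [SimpleGraph.Walk.support_cons]
      exact List.mem_cons_of_mem _ (hsub hx)
    · push Not at hlow
      have hv₁ : a ≤ f v₁ := hlow v₁ p'.start_mem_support
      have hvv' : v' = v := by
        rw [SimpleGraph.Walk.support_cons, List.mem_cons] at hv'
        rcases hv' with h' | h'
        · exact h'
        · exact absurd (hlow v' h') (not_le.2 hlt)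
      subst hvv'
      have hstep := hf _ _ h
      refine ⟨v₁, by omega, p', hlow, fun x hx => ?_⟩
      rw [SimpleGraph.Walk.support_cons]
      exact List.mem_cons_of_mem _ hx

/-! ### §3 First exit from an interior region -/

/-- **First exit.**  Let `I` ("interior") and `R` ("region") be vertex sets and `P` a vertex predicate
such that interior `P`-vertices lie in `R` and every `H`-neighbour satisfying `P` of an interior vertex
lies in `R`.  Then a walk all of whose vertices satisfy `P`, from an interior vertex to a non-interior
one, has an initial segment inside `H.induce R` ending at a non-interior vertex (induction on the walk,
as in `exists_innerBoundary_reachable_of_walk`). -/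
theorem first_exit {V : Type*} {H : SimpleGraph V} {P : V → Prop} {R I : Set V}
    (hIR : ∀ u, u ∈ I → P u → u ∈ R) (hstep : ∀ u v, H.Adj u v → u ∈ I → P v → v ∈ R) :
    ∀ {v b : V} (q : H.Walk v b), (∀ v' ∈ q.support, P v') → v ∈ I → b ∉ I →
      ∃ y, y ∉ I ∧ ∃ (hv : v ∈ R) (hy : y ∈ R), (H.induce R).Reachable ⟨v, hv⟩ ⟨y, hy⟩ := by
  intro v b q
  induction q with
  | nil => intro _ hv hb; exact absurd hv hb
  | @cons v v₁ _ h q' ih =>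
    intro hP hv hb
    have hPv : P v := hP v (by simp)
    have hPv₁ : P v₁ := hP v₁ (by simp)
    have hvR : v ∈ R := hIR v hv hPv
    have hv₁R : v₁ ∈ R := hstep v v₁ h hv hPv₁
    have hadj : (H.induce R).Adj ⟨v, hvR⟩ ⟨v₁, hv₁R⟩ := SimpleGraph.induce_adj.2 h
    by_cases hv₁I : v₁ ∈ I
    · obtain ⟨y, hyI, _, hyR, hreach⟩ :=
        ih (fun v' hv' => hP v' (by simp [hv'])) hv₁I hb
      exact ⟨y, hyI, hvR, hyR, hadj.reachable.trans hreach⟩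
    · exact ⟨v₁, hv₁I, hvR, hv₁R, hadj.reachable⟩

end StubSlabTiling

open StubSlabTiling in
/-- **Slab tiling (deterministic, lattice configurations).**  If `1 ≤ n`, `n + 1 ≤ a`, `n + 1 ≤ L`,
`a + L = 2ln`, `ω ⊆ E(ℤ³)`, and every tile `z_t + A(n, L)`, `t = (i, σ, w) ∈ univ ×ˢ ({1,-1} ×ˢ box l)`,
`z_t = update ((2n+1) • w) i (σ a)`, is front-blocked (no `ω`-open path from `z_t + box n` to
`z_t + ∂ⁱⁿ box L` inside `{v | v - z_t ∈ box L ∧ 0 ≤ σ (v - z_t)_i}`), then the annulus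
`box n → ∂ⁱⁿ box (2ln)` has no `ω`-open crossing inside `box (2ln)`.  Proof: last exit of the crossing
below the level `σ v_i = a` (face of the endpoint), grid rounding of the exit vertex to a tile centre, and
first exit of the tail from the tile interior `z_t + box (L-1)` — see the module docstring. -/
theorem stub_slabTiling :
    ∀ (n l a L : ℕ), 1 ≤ n → n + 1 ≤ a → n + 1 ≤ L → a + L = 2 * l * n →
      ∀ ω : BondConfig (Site 3), ω ⊆ (zdGraph 3).edgeSet →
        (∀ t ∈ (Finset.univ : Finset (Fin 3)) ×ˢ (({1, -1} : Finset ℤ) ×ˢ box 3 l), ω ∈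
          {ω : BondConfig (Site 3) | ¬ ∃ x ∈ (box 3 n).image (· + (Function.update ((2 * (n : ℤ) + 1) • t.2.2) t.1 (t.2.1 * (a : ℤ)))), ∃ y ∈ (innerBoundary (zdGraph 3) (box 3 L)).image (· + (Function.update ((2 * (n : ℤ) + 1) • t.2.2) t.1 (t.2.1 * (a : ℤ)))), ω ∈ openConnIn {v : Site 3 | v - (Function.update ((2 * (n : ℤ) + 1) • t.2.2) t.1 (t.2.1 * (a : ℤ))) ∈ box 3 L ∧ 0 ≤ t.2.1 * (v t.1 - (Function.update ((2 * (n : ℤ) + 1) • t.2.2) t.1 (t.2.1 * (a : ℤ))) t.1)} x y}) →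
        ¬ ∃ x ∈ box 3 n, ∃ y ∈ innerBoundary (zdGraph 3) (box 3 (2 * l * n)),
          ω ∈ openConnIn (↑(box 3 (2 * l * n)) : Set (Site 3)) x y := by
  intro n l a L hn ha hL haL ω hω htiles
  obtain ⟨K, rfl⟩ : ∃ K, L = K + 1 := ⟨L - 1, by omega⟩
  have hM : 2 * (l : ℤ) * n = ((a + (K + 1) : ℕ) : ℤ) := by exact_mod_cast haL.symm
  rw [← haL]
  rintro ⟨x₀, hx₀, b, hb, hx₀M, hbM, ⟨γ⟩⟩
  -- the crossing as a walk of the open graph, with support in the big box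
  obtain ⟨p₀, hp₀⟩ : ∃ p₀ : (openGraph ω).Walk x₀ b, ∀ v ∈ p₀.support, v ∈ box 3 (a + (K + 1)) := by
    have h : ∀ v ∈ (γ.map (SimpleGraph.Embedding.induce
        (↑(box 3 (a + (K + 1))) : Set (Site 3))).toHom).support, v ∈ box 3 (a + (K + 1)) := by
      intro v hv
      rw [SimpleGraph.Walk.support_map, List.mem_map] at hv
      obtain ⟨v', -, rfl⟩ := hv
      exact v'.2
    exact ⟨_, h⟩
  -- the face of the endpoint and its sign
  obtain ⟨i, hi⟩ := exists_eq_of_mem_innerBoundary_box hb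
  obtain ⟨σ, hσ, hσb⟩ : ∃ σ : ℤ, (σ = 1 ∨ σ = -1) ∧ σ * b i = ((a + (K + 1) : ℕ) : ℤ) := by
    rcases hi with h | h
    · exact ⟨1, Or.inl rfl, by rw [h, one_mul]⟩
    · exact ⟨-1, Or.inr rfl, by rw [h]; ring⟩
  have hf : ∀ u v, (openGraph ω).Adj u v → σ * v i ≤ σ * u i + 1 := by
    intro u v huv
    have := zdGraph_adj_apply_le (zdGraph_adj_of_openGraph_adj hω huv) i
    rcases hσ with rfl | rfl <;> omega
  -- (A) last exit below the level `a`
  have hx₀a : σ * x₀ i < a := by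
    have := (mem_box.1 hx₀) i
    rcases hσ with rfl | rfl <;> omega
  obtain ⟨u, hu, q, hq, hqsub⟩ := last_exit (fun v => σ * v i) a hf p₀ (by push_cast at hσb ⊢; omega)
    ⟨x₀, p₀.start_mem_support, hx₀a⟩
  beta_reduce at hu hq
  have huM : u ∈ box 3 (a + (K + 1)) := hp₀ u (hqsub q.start_mem_support)
  -- (B) the tile containing `u`
  set w : Site 3 := fun j => if j = i then 0 else (u j + n) / (2 * (n : ℤ) + 1) with hw
  have hwj : ∀ j, j ≠ i → w j = (u j + n) / (2 * (n : ℤ) + 1) := fun j hj => by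
    simp only [hw, if_neg hj]
  have hwi : w i = 0 := by simp only [hw, if_true]
  have hwbox : w ∈ box 3 l := by
    rw [mem_box]
    intro j
    rcases eq_or_ne j i with rfl | hj
    · rw [hwi]
      constructor <;> omega
    · rw [hwj j hj]
      have huj := (mem_box.1 huM) j
      exact ediv_mem_range hM huj
  have hmem : (i, σ, w) ∈ (Finset.univ : Finset (Fin 3)) ×ˢ (({1, -1} : Finset ℤ) ×ˢ box 3 l) :=
    Finset.mem_product.2 ⟨Finset.mem_univ _, Finset.mem_product.2
      ⟨Finset.mem_insert.2 (hσ.imp_right Finset.mem_singleton.2), hwbox⟩⟩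
  have ht := htiles (i, σ, w) hmem
  simp only [Set.mem_setOf_eq] at ht
  set z : Site 3 := Function.update ((2 * (n : ℤ) + 1) • w) i (σ * (a : ℤ)) with hz
  have hzi : z i = σ * a := by simp only [hz, Function.update_self]
  have hzj : ∀ j, j ≠ i → z j = (2 * (n : ℤ) + 1) * w j := fun j hj => by
    simp only [hz, Function.update_of_ne hj, Pi.smul_apply, smul_eq_mul]
  have huz : u - z ∈ box 3 n := by
    rw [mem_box]
    intro j
    rw [Pi.sub_apply]
    rcases eq_or_ne j i with rfl | hj
    · rw [hzi]
      rcases hσ with rfl | rfl <;> omega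
    · rw [hzj j hj, hwj j hj]
      exact sub_mul_ediv_mem n (u j)
  -- (C)/(D) first exit of the tail from the tile interior, inside the front half-box
  have hIR : ∀ v, v ∈ {v : Site 3 | v - z ∈ box 3 K} → 0 ≤ σ * (v i - z i) →
      v ∈ {v : Site 3 | v - z ∈ box 3 (K + 1) ∧ 0 ≤ σ * (v i - z i)} :=
    fun v hv hPv => ⟨box_mono 3 (Nat.le_succ K) hv, hPv⟩
  have hstep : ∀ v v', (openGraph ω).Adj v v' → v ∈ {v : Site 3 | v - z ∈ box 3 K} →
      0 ≤ σ * (v' i - z i) → v' ∈ {v : Site 3 | v - z ∈ box 3 (K + 1) ∧ 0 ≤ σ * (v i - z i)} := by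
    intro v v' hvv' hv hPv'
    refine ⟨?_, hPv'⟩
    have hc := zdGraph_adj_apply_le (zdGraph_adj_of_openGraph_adj hω hvv')
    have hv' : v - z ∈ box 3 K := hv
    rw [mem_box] at hv' ⊢
    intro j
    have h1 := hv' j
    have h2 := hc j
    simp only [Pi.sub_apply] at h1 ⊢
    push_cast at h1 ⊢
    omega
  have hqP : ∀ v' ∈ q.support, 0 ≤ σ * (v' i - z i) := by
    intro v' hv'
    rw [hzi, sign_mul_sub hσ]
    linarith [hq v' hv']
  have huI : u ∈ {v : Site 3 | v - z ∈ box 3 K} :=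
    box_mono 3 (by omega : n ≤ K) huz
  have hbI : b ∉ {v : Site 3 | v - z ∈ box 3 K} := by
    intro hbz
    have hbz' : b - z ∈ box 3 K := hbz
    have := (mem_box.1 hbz') i
    rw [Pi.sub_apply, hzi] at this
    push_cast at hσb this
    rcases hσ with rfl | rfl <;> omega
  obtain ⟨y, hyI, huR, hyR, hreach⟩ := first_exit hIR hstep q hqP huI hbI
  have hyIB : y - z ∈ innerBoundary (zdGraph 3) (box 3 (K + 1)) :=
    Literature.Probability.LatticeModels.mem_innerBoundary_box_succ_of_notMem hyR.1 hyI
  exact ht ⟨u, Finset.mem_image.2 ⟨u - z, huz, sub_add_cancel u z⟩, y,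
    Finset.mem_image.2 ⟨y - z, hyIB, sub_add_cancel y z⟩, huR, hyR, hreach⟩

end Summit.CriticalPhenomena.PercolationContinuityZ3.Theorems

end
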